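import Summits.Ventures.HSemireg.WedgeHankelRecurrenceGaussHankelGram

/-!
# Venture HSemireg — **THE RECURRENCE COEFFICIENTS FROM THE MEASURE**: for the orthogonal polynomials of a positive discrete measure obeying `q_{k+2} = (X − a_{k+1}) q_{k+1} − b_{k+1} q_k`:
# `a_n h_n = Σ_l ν_l w_l q_n(w_l)²` (so `a_n` is the Rayleigh quotient of `q_n` and lies between the extreme Gauss nodes, hence inside `[min w, max w]`), `b_n = h_n ∕ h_{n−1}`, and in terms of the
# moment determinants `D_n = det (s_{i+j})_{i,j≤n}`: `b_{n+1} = D_{n+1} D_{n−1} ∕ D_n²`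

HONEST FRAMING. Part of the Lean index of the computation cell `pub-hsemireg` (seat p10 gen 43, Sunday typer «UNIFORM-IN-n»).  Real polynomials, finite sums and the determinants of N302 only;
no variety, no cohomology theory, no sheaf, no Ext group and no semiregularity map is constructed here; nothing here says that HC / HC_CM / HC_AV holds; no Literature fact (unproved `Prop`) is
declared or used.  Custodian versions as in `WedgeHankelSiegelIdeal` (1/3).
SOURCES (cited).  T. S. Chihara, *An Introduction to Orthogonal Polynomials* (1978), Ch. I Thm 4.2 (`c_{n+1} = L[x P_n²] ∕ L[P_n²]`, `λ_{n+1} = L[P_n²] ∕ L[P_{n−1}²]`), Ex. 4.3 (`λ_{n+1} = Δ_{n−1}Δ_{n+1} ∕ Δ_n²`),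
Ch. IV Thm 2.1–2.2 (the `c_n` lie in the true interval of orthogonality); G. Szegő, *Orthogonal Polynomials*, Thm 3.2.1 and (2.2.15); W. Gautschi, *Orthogonal Polynomials: Computation and
Approximation* (2004), Thm 1.27–1.28 (Stieltjes procedure / Darboux's formulae).
PROOF TYPED HERE.  `Σ ν w q_n² = Σ ν (X q_n) q_n` with `X q_n = q_{n+1} + a_n q_n + b_n q_{n−1}` and orthogonality; the bounds are N301 `rayleigh_le_gaussNode_last` ∕ `gaussNode_zero_le_rayleigh`
applied to `P = q_n` and the elementary `min w ≤ Σ ν w P² ∕ Σ ν P² ≤ max w`; the determinant ratio is N302 `det_hankelSq_secSeq_eq_prod_norms` with N299 `sum_sq_succ_eq_b_mul_sum_sq`.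
DEDUP DISCLOSURE (`rg -n 'a_mul_norm|diag_coeff|recurrence_coeff|darboux_formula' Summits/Ventures/HSemireg`, 2026-09-03): N273 `three_term_recurrence` OUTPUTS `a, b` with these two identities
for the coefficients it constructs; here they are derived for ANY recurrence extending the orthogonal system (so that they identify its coefficients), together with the bounds and the
determinant ratio.  The 6 names below: 0 hits tree-wide.

WHAT IS IN THE TREE.  N273 `sum_mul_eval_sq_pos_of_natDegree_lt`; N279 `recurrence_monic_natDegree`; N299 `sum_sq_succ_eq_b_mul_sum_sq`; N301 `rayleigh_le_gaussNode_last`, `gaussNode_zero_le_rayleigh`;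
N302 `det_hankelSq_secSeq_eq_prod_norms`; Mathlib `Finset.exists_max_image`, `Finset.sum_le_sum`.
THIS FILE (namespace `Summit.Ventures.HSemireg.Wedge.HankelOuter` continued; CHAINED on N302 (import), N273, N279, N299, N301; 0 definitions):
* §1068 **`a_mul_norm_eq_sum_mul_node_mul_sq`** (`a_n h_n = Σ_l ν_l w_l q_n(w_l)²`), **`b_eq_norm_div_norm`** (`b_{n+1} = h_{n+1} ∕ h_n`), **`a_mem_Icc_gaussNodes`** (`z_0 ≤ a_n ≤ z_t` for every exact
  rule with `t + 1 > n` nodes and non-negative weights), `sum_mul_node_mul_sq_le_sup` ∕ **`a_mem_Icc_support`** (`min_l w_l ≤ a_n ≤ max_l w_l`, as `∃ l l′, w_l ≤ a_n ≤ w_{l′}`),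
  **`b_eq_det_mul_det_div_det_sq`** (`b_{n+2} = D_{n+2} D_n ∕ D_{n+1}²`).
CAVEATS.  Positive discrete measures with enough atoms (`N > n + 1`, resp. `> n + 2`).  Nothing Ext-side.  New names only.
-/

open Module Polynomial
open scoped Matrix Polynomial
open Summit.Ventures.HSemireg.Wedge.HankelSecant (secSeq)

namespace Summit.Ventures.HSemireg.Wedge.HankelOuter

/-! ## §1068. The recurrence coefficients `a_n`, `b_n` from the measure -/

/-- **`a_n h_n = Σ_l ν_l w_l q_n(w_l)²`**: the diagonal recurrence coefficient is the Rayleigh quotient of `q_n` (orthogonality of `q_n` against `q_{n−1}` and `q_{n+1}` against `q_n`).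
[Chihara I Thm 4.2 (a); Gautschi Thm 1.27; this file, §1068] -/
theorem a_mul_norm_eq_sum_mul_node_mul_sq {N : ℕ} {ν w : Fin N → ℝ} {q : ℕ → ℝ[X]} {a b : ℕ → ℝ} (hq0 : q 0 = 1) (hq1 : q 1 = Polynomial.X - C (a 0))
    (hrec : ∀ n, q (n + 2) = (Polynomial.X - C (a (n + 1))) * q (n + 1) - C (b (n + 1)) * q n) (n : ℕ)
    (horth : ∀ k, k ≤ n + 1 → ∀ G : ℝ[X], G.natDegree < k → ∑ l, ν l * (q k * G).eval (w l) = 0) :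
    a n * ∑ l, ν l * ((q n).eval (w l)) ^ 2 = ∑ l, ν l * (w l * ((q n).eval (w l)) ^ 2) := by
  have hmd := recurrence_monic_natDegree hq0 hq1 hrec
  rcases Nat.eq_zero_or_pos n with h0 | hpos
  · subst h0
    -- `X q_0 = q_1 + a_0 q_0`
    have h1 := horth 1 (by omega) (q 0) (by rw [(hmd 0).2]; omega)
    have hl : ∀ l, ν l * (w l * ((q 0).eval (w l)) ^ 2) = ν l * (q 1 * q 0).eval (w l) + a 0 * (ν l * ((q 0).eval (w l)) ^ 2) := fun l => by
      rw [hq1, hq0]; simp only [eval_mul, eval_sub, eval_X, eval_C, eval_one]; ring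
    rw [Finset.sum_congr rfl fun l _ => hl l, Finset.sum_add_distrib, ← Finset.mul_sum, h1, zero_add]
  · obtain ⟨k, rfl⟩ : ∃ k, n = k + 1 := ⟨n - 1, by omega⟩
    -- `X q_{k+1} = q_{k+2} + a_{k+1} q_{k+1} + b_{k+1} q_k`
    have h2 := horth (k + 2) le_rfl (q (k + 1)) (by rw [(hmd (k + 1)).2]; omega)
    have h1 := horth (k + 1) (by omega) (q k) (by rw [(hmd k).2]; omega)
    have hl : ∀ l, ν l * (w l * ((q (k + 1)).eval (w l)) ^ 2) =
        ν l * (q (k + 2) * q (k + 1)).eval (w l) + a (k + 1) * (ν l * ((q (k + 1)).eval (w l)) ^ 2) + b (k + 1) * (ν l * (q (k + 1) * q k).eval (w l)) := fun l => by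
      rw [hrec k]; simp only [eval_mul, eval_sub, eval_X, eval_C]; ring
    rw [Finset.sum_congr rfl fun l _ => hl l, Finset.sum_add_distrib, Finset.sum_add_distrib, ← Finset.mul_sum, ← Finset.mul_sum, h2, h1, zero_add, mul_zero, add_zero]

/-- **`b_{n+1} = h_{n+1} ∕ h_n`** for a positive discrete measure (`N > n + 1` atoms). [Chihara I Thm 4.2 (c); Gautschi Thm 1.27; this file, §1068] -/
theorem b_eq_norm_div_norm {N : ℕ} {ν w : Fin N → ℝ} (hν : ∀ l, 0 < ν l) (hw : Function.Injective w) {q : ℕ → ℝ[X]} {a b : ℕ → ℝ} (hq0 : q 0 = 1) (hq1 : q 1 = Polynomial.X - C (a 0))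
    (hrec : ∀ n, q (n + 2) = (Polynomial.X - C (a (n + 1))) * q (n + 1) - C (b (n + 1)) * q n) {n : ℕ} (hnN : n < N)
    (horth : ∀ k, k ≤ n + 2 → ∀ G : ℝ[X], G.natDegree < k → ∑ l, ν l * (q k * G).eval (w l) = 0) :
    b (n + 1) = (∑ l, ν l * ((q (n + 1)).eval (w l)) ^ 2) / ∑ l, ν l * ((q n).eval (w l)) ^ 2 := by
  have hmd := recurrence_monic_natDegree hq0 hq1 hrec
  have hpos : 0 < ∑ l, ν l * ((q n).eval (w l)) ^ 2 := sum_mul_eval_sq_pos_of_natDegree_lt hν hw (hmd n).1.ne_zero (by rw [(hmd n).2]; exact hnN)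
  rw [eq_div_iff hpos.ne', sum_sq_succ_eq_b_mul_sum_sq hq0 hq1 hrec n (horth (n + 1) (by omega)) (horth (n + 2) le_rfl)]

/-- **`z_0 ≤ a_n ≤ z_t`**: the diagonal coefficient `a_n` lies between the extreme nodes of EVERY rule `(λ, z)` with `λ ≥ 0`, `z_0 < ⋯ < z_t`, `t ≥ n`, exact for the measure in degree `≤ 2t + 1`.
[Chihara IV Thm 2.1–2.2; Szegő Thm 7.72.1; this file, §1068] -/
theorem a_mem_Icc_gaussNodes {N t : ℕ} {ν w : Fin N → ℝ} (hν : ∀ l, 0 < ν l) (hw : Function.Injective w) {q : ℕ → ℝ[X]} {a b : ℕ → ℝ} (hq0 : q 0 = 1)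
    (hq1 : q 1 = Polynomial.X - C (a 0)) (hrec : ∀ n, q (n + 2) = (Polynomial.X - C (a (n + 1))) * q (n + 1) - C (b (n + 1)) * q n) {n : ℕ} (hnt : n ≤ t) (hnN : n < N)
    (horth : ∀ k, k ≤ n + 1 → ∀ G : ℝ[X], G.natDegree < k → ∑ l, ν l * (q k * G).eval (w l) = 0) {μ z : Fin (t + 1) → ℝ} (hz : StrictMono z) (hμ : ∀ k, 0 ≤ μ k)
    (hmom : ∀ p, p ≤ 2 * t + 1 → ∑ k, μ k * z k ^ p = ∑ l, ν l * w l ^ p) :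
    z 0 ≤ a n ∧ a n ≤ z (Fin.last t) := by
  have hmd := recurrence_monic_natDegree hq0 hq1 hrec
  have hpos : 0 < ∑ l, ν l * ((q n).eval (w l)) ^ 2 := sum_mul_eval_sq_pos_of_natDegree_lt hν hw (hmd n).1.ne_zero (by rw [(hmd n).2]; exact hnN)
  have ha := a_mul_norm_eq_sum_mul_node_mul_sq hq0 hq1 hrec n horth
  have hdeg : (q n).natDegree ≤ t := by rw [(hmd n).2]; exact hnt
  have h1 := gaussNode_zero_le_rayleigh hz hμ hmom hdeg
  have h2 := rayleigh_le_gaussNode_last hz hμ hmom hdeg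
  rw [← ha] at h1 h2
  exact ⟨le_of_mul_le_mul_right h1 hpos, le_of_mul_le_mul_right h2 hpos⟩

/-- **`Σ_l ν_l w_l P(w_l)²` is pinned by the extreme atoms**: for `ν ≥ 0` and any `P`, there are atoms `l₀, l₁` with `w_{l₀} Σ_l ν_l P(w_l)² ≤ Σ_l ν_l w_l P(w_l)² ≤ w_{l₁} Σ_l ν_l P(w_l)²` (`N ≥ 1`).
[mechanism; this file, §1068] -/
theorem sum_mul_node_mul_sq_le_sup {N : ℕ} {ν w : Fin (N + 1) → ℝ} (hν : ∀ l, 0 ≤ ν l) (P : ℝ[X]) :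
    ∃ l₀ l₁ : Fin (N + 1), w l₀ * ∑ l, ν l * (P.eval (w l)) ^ 2 ≤ ∑ l, ν l * (w l * (P.eval (w l)) ^ 2) ∧
      ∑ l, ν l * (w l * (P.eval (w l)) ^ 2) ≤ w l₁ * ∑ l, ν l * (P.eval (w l)) ^ 2 := by
  obtain ⟨l₀, -, hl₀⟩ := Finset.exists_min_image Finset.univ w Finset.univ_nonempty
  obtain ⟨l₁, -, hl₁⟩ := Finset.exists_max_image Finset.univ w Finset.univ_nonempty
  refine ⟨l₀, l₁, ?_, ?_⟩
  · rw [Finset.mul_sum]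
    refine Finset.sum_le_sum fun l _ => ?_
    rw [mul_left_comm]
    exact mul_le_mul_of_nonneg_left (mul_le_mul_of_nonneg_right (hl₀ l (Finset.mem_univ l)) (sq_nonneg _)) (hν l)
  · rw [Finset.mul_sum]
    refine Finset.sum_le_sum fun l _ => ?_
    rw [mul_left_comm (w l₁)]
    exact mul_le_mul_of_nonneg_left (mul_le_mul_of_nonneg_right (hl₁ l (Finset.mem_univ l)) (sq_nonneg _)) (hν l)

/-- **`min_l w_l ≤ a_n ≤ max_l w_l`**: the diagonal recurrence coefficients of a positive discrete measure lie in the convex hull of its support (`∃ l₀ l₁, w_{l₀} ≤ a_n ≤ w_{l₁}`).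
[Chihara IV Thm 2.2; Gautschi Thm 1.27; this file, §1068] -/
theorem a_mem_Icc_support {N : ℕ} {ν w : Fin (N + 1) → ℝ} (hν : ∀ l, 0 < ν l) (hw : Function.Injective w) {q : ℕ → ℝ[X]} {a b : ℕ → ℝ} (hq0 : q 0 = 1)
    (hq1 : q 1 = Polynomial.X - C (a 0)) (hrec : ∀ n, q (n + 2) = (Polynomial.X - C (a (n + 1))) * q (n + 1) - C (b (n + 1)) * q n) {n : ℕ} (hnN : n < N + 1)
    (horth : ∀ k, k ≤ n + 1 → ∀ G : ℝ[X], G.natDegree < k → ∑ l, ν l * (q k * G).eval (w l) = 0) :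
    ∃ l₀ l₁ : Fin (N + 1), w l₀ ≤ a n ∧ a n ≤ w l₁ := by
  have hmd := recurrence_monic_natDegree hq0 hq1 hrec
  have hpos : 0 < ∑ l, ν l * ((q n).eval (w l)) ^ 2 := sum_mul_eval_sq_pos_of_natDegree_lt hν hw (hmd n).1.ne_zero (by rw [(hmd n).2]; exact hnN)
  have ha := a_mul_norm_eq_sum_mul_node_mul_sq hq0 hq1 hrec n horth
  obtain ⟨l₀, l₁, h1, h2⟩ := sum_mul_node_mul_sq_le_sup (w := w) (fun l => (hν l).le) (q n)
  rw [← ha] at h1 h2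
  exact ⟨l₀, l₁, le_of_mul_le_mul_right h1 hpos, le_of_mul_le_mul_right h2 hpos⟩

/-- **`b_{n+2} = D_{n+2} D_n ∕ D_{n+1}²`** with `D_m = det (Σ_l ν_l w_l^{i+j})_{i,j≤m}` the moment determinants (positive discrete measure, `N > n + 2` atoms). [Chihara I Ex. 4.3; Szegő (2.2.15); this file, §1068] -/
theorem b_eq_det_mul_det_div_det_sq {N : ℕ} {ν w : Fin N → ℝ} (hν : ∀ l, 0 < ν l) (hw : Function.Injective w) {q : ℕ → ℝ[X]} {a b : ℕ → ℝ} (hq0 : q 0 = 1)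
    (hq1 : q 1 = Polynomial.X - C (a 0)) (hrec : ∀ n, q (n + 2) = (Polynomial.X - C (a (n + 1))) * q (n + 1) - C (b (n + 1)) * q n) {n : ℕ} (hnN : n + 2 < N)
    (horth : ∀ k, k ≤ n + 3 → ∀ G : ℝ[X], G.natDegree < k → ∑ l, ν l * (q k * G).eval (w l) = 0) :
    b (n + 2) = (hankelSq ℝ (n + 2) (secSeq ℝ ν w)).det * (hankelSq ℝ n (secSeq ℝ ν w)).det / (hankelSq ℝ (n + 1) (secSeq ℝ ν w)).det ^ 2 := by
  have hmd := recurrence_monic_natDegree hq0 hq1 hrec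
  have hpair : ∀ m, m + 1 ≤ n + 3 → ∀ i j, i ≤ m → j ≤ m → i ≠ j → ∑ l, ν l * ((q i).eval (w l) * (q j).eval (w l)) = 0 := by
    intro m hm i j hi hj hij
    rcases lt_or_gt_of_ne hij with h | h
    · have := horth j (by omega) (q i) (by rw [(hmd i).2]; exact h)
      rw [← this]; exact Finset.sum_congr rfl fun l _ => by rw [eval_mul, mul_comm ((q i).eval _)]
    · have := horth i (by omega) (q j) (by rw [(hmd j).2]; exact h)
      rw [← this]; exact Finset.sum_congr rfl fun l _ => by rw [eval_mul]
  have hD : ∀ m, m + 1 ≤ n + 3 → (hankelSq ℝ m (secSeq ℝ ν w)).det = ∏ k : Fin (m + 1), ∑ l, ν l * ((q k).eval (w l)) ^ 2 := fun m hm =>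
    det_hankelSq_secSeq_eq_prod_norms ν w (fun k _ => (hmd k).1) (fun k _ => (hmd k).2) (hpair m hm)
  have hh : ∀ k, k ≤ n + 2 → 0 < ∑ l, ν l * ((q k).eval (w l)) ^ 2 := fun k hk =>
    sum_mul_eval_sq_pos_of_natDegree_lt hν hw (hmd k).1.ne_zero (by rw [(hmd k).2]; omega)
  rw [b_eq_norm_div_norm hν hw hq0 hq1 hrec (n := n + 1) (by omega) horth, hD (n + 2) le_rfl, hD (n + 1) (by omega), hD n (by omega),
    Fin.prod_univ_castSucc (n := n + 2), Fin.prod_univ_castSucc (n := n + 1), Fin.prod_univ_castSucc (n := n + 1)]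
  simp only [Fin.val_castSucc, Fin.val_last]
  have hP : 0 < ∏ i : Fin (n + 1), ∑ l, ν l * ((q (i : ℕ)).eval (w l)) ^ 2 := Finset.prod_pos fun i _ => hh i (by have := i.isLt; omega)
  rw [div_eq_div_iff (hh (n + 1) (by omega)).ne' (pow_pos (mul_pos hP (hh (n + 1) (by omega))) 2).ne']
  ring

end Summit.Ventures.HSemireg.Wedge.HankelOuter
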